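import Summits.Ventures.PercRepro.Night2FatDegGeomB

/-!
# night-2: the basis points and the points of `W ∖ {x}` of a lossy basis pair in the two-planes regime

For a basis pair `(B, z)` with `Q = insert z B`, `w₀ ∈ Q`, `x ∉ Q`: the BASIS POINTS `P₀ = (Q ∖ K) ∖ {w₀}` (four
points, independent, inside `V = (G ∖ K) ∖ {w₀, x}`), the points `W ∖ {x} = (G ∖ Q) ∖ {x}` (inside `V`, disjoint from
`P₀`), and `V = P₀ ∪ (W ∖ {x})`; every point of `V` is on the spine, in `π₂` off the spine, or in `π₃` off the spine.
* **`basis_points_indep`**, **`card_basis_points`**, **`basis_points_subset_V`**, **`W_subset_V`**,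
  **`mem_basis_or_W_of_mem_V`**, **`basis_point_notMem_W`**, **`w₀_notMem_clF_V`**, **`spine_or_plane_or_side`**.
Paper `proofs/NIGHT-2-g35.md` §4.
-/

namespace PercRepro.Shadow

open PercRepro.ThmH PercRepro.PerFlat

variable {α : Type*} [DecidableEq α] {M : Matroid α} [M.Finite] {G : Finset α}

/-- The basis points are independent. -/
theorem basis_points_indep (hG : G ∈ flatsQ M (5 + 1)) (hd : (gr M \ G).card = 2) (hk : kColoops M G = 1)
    {B : Finset α} (hB : B ∈ thinMembers M 5 G) (hnP : ¬ bigP M G B) {z : α} (hz : z ∈ G \ clF M B) {w₀ : α} :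
    M.Indep (((insert z B \ coloops M G).erase w₀ : Finset α) : Set α) := by
  have hQ5 := card_insert_sdiff_eq_five hG hd hk hB hnP hz
  have hrk5 := rkN_insert_sdiff_coloops_eq_five_of_thin hG hd hk hB hz
  have hind : M.Indep ((insert z B \ coloops M G : Finset α) : Set α) :=
    indep_of_rkN_eq_card (by rw [hrk5, hQ5])
  exact hind.subset (by exact_mod_cast (Finset.erase_subset _ _))

/-- Four basis points. -/
theorem card_basis_points (hG : G ∈ flatsQ M (5 + 1)) (hd : (gr M \ G).card = 2) (hk : kColoops M G = 1)
    {B₀ : Finset α} (hB₀ : B₀ ∈ thinMembers M 5 G) {w₀ x : α} (hD : G \ clF M B₀ = {w₀, x})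
    {B : Finset α} (hB : B ∈ thinMembers M 5 G) (hnP : ¬ bigP M G B) {z : α} (hz : z ∈ G \ clF M B)
    (hw₀ : w₀ ∈ insert z B) : ((insert z B \ coloops M G).erase w₀).card = 4 := by
  have hd' : (gr M \ G).card ≤ 5 := by omega
  have hGg : G ⊆ gr M := (mem_flatsQ.1 hG).1
  have hQ5 := card_insert_sdiff_eq_five hG hd hk hB hnP hz
  have hw₀K : w₀ ∉ coloops M G := by
    intro h'
    have h1 : w₀ ∈ clF M B₀ := subset_clF_of_subset_gr ((subset_G_of_mem_thinMembers hB₀).trans hGg)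
      (coloops_subset_of_mem_thinMembers hG hd' hB₀ h')
    have h2 : w₀ ∈ G \ clF M B₀ := by
      rw [hD]
      exact Finset.mem_insert_self _ _
    exact (Finset.mem_sdiff.1 h2).2 h1
  rw [Finset.card_erase_of_mem (Finset.mem_sdiff.2 ⟨hw₀, hw₀K⟩), hQ5]

/-- The basis points lie in `V = (G ∖ K) ∖ {w₀, x}`. -/
theorem basis_points_subset_V {B : Finset α} (hB : B ∈ thinMembers M 5 G)
    {z : α} (hz : z ∈ G \ clF M B) {w₀ x : α} (hx : x ∉ insert z B) :
    (insert z B \ coloops M G).erase w₀ ⊆ (G \ coloops M G) \ {w₀, x} := by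
  have hQG : insert z B ⊆ G :=
    Finset.insert_subset (Finset.mem_sdiff.1 hz).1 (subset_G_of_mem_thinMembers hB)
  intro e he
  rw [Finset.mem_erase, Finset.mem_sdiff] at he
  rw [Finset.mem_sdiff, Finset.mem_sdiff, Finset.mem_insert, Finset.mem_singleton]
  refine ⟨⟨hQG he.2.1, he.2.2⟩, ?_⟩
  rintro (rfl | rfl)
  · exact he.1 rfl
  · exact hx he.2.1

/-- The points of `W ∖ {x}` lie in `V`. -/
theorem W_subset_V (hG : G ∈ flatsQ M (5 + 1)) (hd : (gr M \ G).card = 2) {B : Finset α}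
    (hB : B ∈ thinMembers M 5 G) {z : α} {w₀ x : α} (hw₀ : w₀ ∈ insert z B) :
    (G \ insert z B).erase x ⊆ (G \ coloops M G) \ {w₀, x} := by
  have hd' : (gr M \ G).card ≤ 5 := by omega
  have hKQ : coloops M G ⊆ insert z B :=
    (coloops_subset_of_mem_thinMembers hG hd' hB).trans (Finset.subset_insert _ _)
  intro e he
  rw [Finset.mem_erase, Finset.mem_sdiff] at he
  rw [Finset.mem_sdiff, Finset.mem_sdiff, Finset.mem_insert, Finset.mem_singleton]
  refine ⟨⟨he.2.1, fun h => he.2.2 (hKQ h)⟩, ?_⟩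
  rintro (rfl | rfl)
  · exact he.2.2 hw₀
  · exact he.1 rfl

/-- A point of `V` is a basis point or a point of `W ∖ {x}`. -/
theorem mem_basis_or_W_of_mem_V {B : Finset α} {z : α} {w₀ x : α} {e : α}
    (he : e ∈ (G \ coloops M G) \ {w₀, x}) :
    e ∈ (insert z B \ coloops M G).erase w₀ ∨ e ∈ (G \ insert z B).erase x := by
  rw [Finset.mem_sdiff, Finset.mem_sdiff, Finset.mem_insert, Finset.mem_singleton, not_or] at he
  by_cases heQ : e ∈ insert z B
  · left
    exact Finset.mem_erase.2 ⟨he.2.1, Finset.mem_sdiff.2 ⟨heQ, he.1.2⟩⟩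
  · right
    exact Finset.mem_erase.2 ⟨he.2.2, Finset.mem_sdiff.2 ⟨he.1.1, heQ⟩⟩

/-- A basis point is not a point of `W ∖ {x}`. -/
theorem basis_point_notMem_W {B : Finset α} {z : α} {w₀ x : α} {e : α}
    (he : e ∈ (insert z B \ coloops M G).erase w₀) : e ∉ (G \ insert z B).erase x := by
  intro h
  exact (Finset.mem_sdiff.1 (Finset.mem_of_mem_erase h)).2 (Finset.mem_sdiff.1 (Finset.mem_of_mem_erase he)).1

/-- `w₀ ∉ clF V`: `V ⊆ clF B₀` and `w₀ ∉ clF B₀`. -/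
theorem w₀_notMem_clF_V {B₀ : Finset α} {w₀ x : α}
    (hD : G \ clF M B₀ = {w₀, x}) : w₀ ∉ clF M ((G \ coloops M G) \ {w₀, x}) := by
  have hVB : (G \ coloops M G) \ {w₀, x} ⊆ clF M B₀ := by
    intro e he
    rw [Finset.mem_sdiff, Finset.mem_sdiff] at he
    by_contra heB
    have : e ∈ G \ clF M B₀ := Finset.mem_sdiff.2 ⟨he.1.1, heB⟩
    rw [hD] at this
    exact he.2 this
  intro h
  have h1 : w₀ ∈ clF M B₀ := clF_subset_clF_of_subset_clF hVB h
  have h2 : w₀ ∈ G \ clF M B₀ := by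
    rw [hD]
    exact Finset.mem_insert_self _ _
  exact (Finset.mem_sdiff.1 h2).2 h1

/-- A point of `V` is on the spine, in `π₂` off the spine, or in `π₃` off the spine. -/
theorem spine_or_plane_or_side {V : Finset α} {R₁ : Finset α} {c₂ c₃ : α}
    (hcover : ∀ e ∈ V, e ∈ clF M (insert c₂ R₁) ∨ e ∈ clF M (insert c₃ R₁)) {e : α} (he : e ∈ V) :
    e ∈ clF M R₁ ∨ (e ∈ clF M (insert c₂ R₁) ∧ e ∉ clF M R₁) ∨ (e ∈ clF M (insert c₃ R₁) ∧ e ∉ clF M R₁) := by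
  by_cases heL : e ∈ clF M R₁
  · exact Or.inl heL
  · rcases hcover e he with h | h
    · exact Or.inr (Or.inl ⟨h, heL⟩)
    · exact Or.inr (Or.inr ⟨h, heL⟩)

end PercRepro.Shadow
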